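import Summits.HodgeConjecture.HodgeConjecture.Theorems.VHCAbelianSchemesRoadDegreeConfinement
import Summits.HodgeConjecture.HodgeConjecture.Theses.VHCAbelianSchemesRoad
import HarnessLib

/-!
# Road b02 (`VHCAbelianSchemesRoad`, D-0059) — the degree confinement stated ON THE ROUTE DECLS (items 19274, 19779) + graded monotonicity

research route conditional on HC_CM; not a corollary; Q11.4-sentence-2 already refuted in dim ≥ 3.

THEOREMS ONLY (no definition, no named fact, no sorry; `HC_CM` occurs nowhere; nothing of the road's research content is claimed).
`VHCAbelianSchemesRoadDegreeConfinement.lean` (p442807) states the confinement over the carrier's constants; this companion imports the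
ROUTE FILE and restates it with the types LITERALLY the route decls
`Summit.HodgeConjecture.HodgeConjecture.Theses.VHCAbelianSchemesRoad.SemiregularSheafRepresentativesTwAt` (crux, stmt-HodgeConjecture-19274)
and `….SemiregularSheafRepresentativesLefAt` (aside, stmt-HodgeConjecture-19779) — both unfold to the carrier statements by `rfl` — so
that the LEAD / the registered skeletons can quote them by name; plus the monotonicity of the graded predicates in the door.

* `semiregularSheafRepresentativesTwAt_iff_midRange` — the crux ⟺ `∀ C n p, 2 ≤ p → p + 2 ≤ n → LefAtExceptionalRegimeAt (twisted door) n p`;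
* `semiregularSheafRepresentativesLefAt_route_iff_midRange` — the aside likewise over `bfSheafClass C`;
* `lefAtExceptionalRegimeAt_six_three_of_semiregularSheafRepresentativesTwAt` — the BC5 rung `(6,3)` is an instance of the crux;
* `LefAtExceptionalRegimeAt.mono`, `AdmissibleRepresentativesLefAtDeg.mono` — graded monotonicity in the door; sheaf ⟹ twisted at
  every `(n, p)`.

References: [cite: Bloch1972Semiregularity, Remark (7.5)] [cite: BuchweitzFlenner2003, §5 Thm. 5.1] [cite: vanGeemen1994HodgeAV, §2.4 and Thm. 4.11]
[cite: MoonenZarhin1999LowDim, Introduction (p. 711)] [cite: Markman2025SecantWeil, Thm. 1.5.1].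
-/

noncomputable section

open CategoryTheory CategoryTheory.Limits AlgebraicGeometry Topology

namespace Summit.HodgeConjecture.HodgeConjecture.Ring2.SemiregularRepresentatives

-- the cell's namespace repeats the summit name (`Summit.HodgeConjecture.HodgeConjecture…`), as in every `Ring2*` file
set_option linter.dupNamespace false

open Literature.AlgebraicGeometry Literature.AlgebraicGeometry.Motives
open Literature.AlgebraicGeometry.HodgeTheory
open Literature.AlgebraicTopology.SingularHomology
open Literature.Barriers.HodgeConjecture (divisorClassesSpan)
open Summit.Ventures.HSemireg (ObjClass bfSheafClass)

/-! ## §1 Graded monotonicity in the door -/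

/-- Regime 2 at `(n, p)` is monotone in the door. [folklore] -/
theorem LefAtExceptionalRegimeAt.mono {𝒪 𝒪' : ObjClass} (h𝒪 : ∀ n X₀ I κ, 𝒪 n X₀ I κ → 𝒪' n X₀ I κ) {n p : ℕ}
    (h : LefAtExceptionalRegimeAt 𝒪 n p) : LefAtExceptionalRegimeAt 𝒪' n p := by
  intro 𝒳 S f hf h𝒳 hirr haff hsm hdim habel he W hW s₀ hs₀ hexc
  obtain ⟨s₁, I, κ, V, a, Z, hpI, hκ, ha, hZ, hVp, hκV, hVH⟩ := h f hf h𝒳 hirr haff hsm hdim habel he W hW s₀ hs₀ hexc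
  exact ⟨s₁, I, κ, V, a, Z, hpI, h𝒪 _ _ _ _ hκ, ha, hZ, hVp, hκV, hVH⟩

/-- K-SR♭∃ at `(n, p)` is monotone in the door. [folklore] -/
theorem AdmissibleRepresentativesLefAtDeg.mono {𝒪 𝒪' : ObjClass} (h𝒪 : ∀ n X₀ I κ, 𝒪 n X₀ I κ → 𝒪' n X₀ I κ) {n p : ℕ}
    (h : AdmissibleRepresentativesLefAtDeg 𝒪 n p) : AdmissibleRepresentativesLefAtDeg 𝒪' n p := by
  intro 𝒳 S f hf h𝒳 hirr haff hsm hdim habel he W hW s₀ hs₀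
  obtain ⟨s₁, I, κ, V, a, Z, hpI, hκ, ha, hZ, hVp, hκV, hVH⟩ := h f hf h𝒳 hirr haff hsm hdim habel he W hW s₀ hs₀
  exact ⟨s₁, I, κ, V, a, Z, hpI, h𝒪 _ _ _ _ hκ, ha, hZ, hVp, hκV, hVH⟩

/-- **Sheaf ⟹ twisted at every `(n, p)`**: regime 2 at `(n, p)` for the sheaf door `bfSheafClass C` implies regime 2 at `(n, p)` for the
twisted door `twistedReflexiveClass C Adm`, every `Adm ⊇ bfSingleAdmissible` (along `bfSheafClass_le_twistedReflexiveClass`).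
[cite: BuchweitzFlenner2003, §5 Thm. 5.1] [cite: Perry2026Semiregularity, Thm. 1.1 (the case B₀ = 0)] -/
theorem lefAtExceptionalRegimeAt_twisted_of_sheaf (C : ChernCharacterBetti) {Adm : PerfectAdmissibility}
    (hAdm : ∀ n X₀ I E, bfSingleAdmissible n X₀ I E → Adm n X₀ I E) {n p : ℕ} (h : LefAtExceptionalRegimeAt (bfSheafClass C) n p) :
    LefAtExceptionalRegimeAt (twistedReflexiveClass C Adm) n p :=
  h.mono (bfSheafClass_le_twistedReflexiveClass C hAdm)

/-! ## §2 The confinement on the route decls -/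

/-- **Crux stmt-HodgeConjecture-19274 ⟺ its middle-range exceptional regime** — the type on the left is LITERALLY the route decl
`Theses.VHCAbelianSchemesRoad.SemiregularSheafRepresentativesTwAt` (rev 12; it unfolds to the twin statement by `rfl`): K-SR♭∃ over the
twisted door holds iff, for every Chern character theory `C` and every `(n, p)` with `2 ≤ p ≤ n − 2`, regime 2 holds at `(n, p)` for
`twistedReflexiveClass C AdmTw`. FIRST PAIR `(4, 2)`. [cite: Bloch1972Semiregularity, Remark (7.5)]
[cite: vanGeemen1994HodgeAV, §2.4 and Thm. 4.11] [cite: MoonenZarhin1999LowDim, Introduction (p. 711)] -/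
theorem semiregularSheafRepresentativesTwAt_iff_midRange :
    Theses.VHCAbelianSchemesRoad.SemiregularSheafRepresentativesTwAt ↔
      ∀ (C : ChernCharacterBetti) (n p : ℕ), 2 ≤ p → p + 2 ≤ n →
        LefAtExceptionalRegimeAt (Literature.AlgebraicGeometry.HodgeTheory.twistedReflexiveClass C
          (fun n X₀ I E => Summit.Ventures.HSemireg.gluableSigmaAdmissible n X₀ I E ∨
            Literature.AlgebraicGeometry.HodgeTheory.bfSingleAdmissible n X₀ I E)) n p :=
  twAt_iff_midRange

/-- **The crux from its middle-range regime** (the direction a reshaped skeleton would use as its `_of`).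
[cite: Bloch1972Semiregularity, Remark (7.5)] [cite: vanGeemen1994HodgeAV, §2.4] -/
theorem semiregularSheafRepresentativesTwAt_of_midRange
    (h : ∀ (C : ChernCharacterBetti) (n p : ℕ), 2 ≤ p → p + 2 ≤ n →
      LefAtExceptionalRegimeAt (Literature.AlgebraicGeometry.HodgeTheory.twistedReflexiveClass C
        (fun n X₀ I E => Summit.Ventures.HSemireg.gluableSigmaAdmissible n X₀ I E ∨
          Literature.AlgebraicGeometry.HodgeTheory.bfSingleAdmissible n X₀ I E)) n p) :
    Theses.VHCAbelianSchemesRoad.SemiregularSheafRepresentativesTwAt :=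
  semiregularSheafRepresentativesTwAt_iff_midRange.2 h

/-- **Aside stmt-HodgeConjecture-19779 ⟺ its middle-range exceptional regime** (type = the route decl
`Theses.VHCAbelianSchemesRoad.SemiregularSheafRepresentativesLefAt`, which is the carrier constant by `rfl`).
[cite: BuchweitzFlenner2003, §5 Thm. 5.1 and Def. 4.10] [cite: vanGeemen1994HodgeAV, §2.4 and Thm. 4.11] -/
theorem semiregularSheafRepresentativesLefAt_route_iff_midRange :
    Theses.VHCAbelianSchemesRoad.SemiregularSheafRepresentativesLefAt ↔
      ∀ (C : ChernCharacterBetti) (n p : ℕ), 2 ≤ p → p + 2 ≤ n → LefAtExceptionalRegimeAt (bfSheafClass C) n p :=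
  semiregularSheafRepresentativesLefAt_iff_midRange

/-- **The BC5 rung is an instance of the crux**: the route's `SemiregularSheafRepresentativesTwAt` gives regime 2 at `(6, 3)` for the
twisted door, every `C` (`= LefAtExceptionalRegimeSixfoldMiddle`, `Iff.rfl`). [cite: Markman2025SecantWeil, Thm. 1.5.1] -/
theorem lefAtExceptionalRegimeAt_six_three_of_semiregularSheafRepresentativesTwAt
    (h : Theses.VHCAbelianSchemesRoad.SemiregularSheafRepresentativesTwAt) (C : ChernCharacterBetti) :
    LefAtExceptionalRegimeAt (Literature.AlgebraicGeometry.HodgeTheory.twistedReflexiveClass C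
      (fun n X₀ I E => Summit.Ventures.HSemireg.gluableSigmaAdmissible n X₀ I E ∨
        Literature.AlgebraicGeometry.HodgeTheory.bfSingleAdmissible n X₀ I E)) 6 3 :=
  semiregularSheafRepresentativesTwAt_iff_midRange.1 h C 6 3 (by norm_num) (by norm_num)

/-- **Conversely the crux needs NOTHING below relative dimension `4`**: every `(n, p)` with `n ≤ 3` (or `p ≤ 1`, or `p ≥ n − 1`) is
served by the void regime, for the twisted door as for any door. [cite: MoonenZarhin1999LowDim, Introduction (p. 711)] -/
theorem lefAtExceptionalRegimeAt_twisted_of_offMidRange (C : ChernCharacterBetti) {n p : ℕ} (hp : p ≤ 1 ∨ n ≤ p + 1) :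
    LefAtExceptionalRegimeAt (Literature.AlgebraicGeometry.HodgeTheory.twistedReflexiveClass C
      (fun n X₀ I E => Summit.Ventures.HSemireg.gluableSigmaAdmissible n X₀ I E ∨
        Literature.AlgebraicGeometry.HodgeTheory.bfSingleAdmissible n X₀ I E)) n p :=
  lefAtExceptionalRegimeAt_of_offMidRange _ hp

end Summit.HodgeConjecture.HodgeConjecture.Ring2.SemiregularRepresentatives

end
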